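import Mathlib
import HarnessLib
import Summits.NavierStokesRegularity.NavierStokesRegularity.Theorems.UnthreadedDoorCellFluxDefs
import Summits.NavierStokesRegularity.NavierStokesRegularity.Theorems.UnthreadedDoorNetFluxEnvelopeToolkit
import Summits.NavierStokesRegularity.NavierStokesRegularity.Theorems.UnthreadedDoorIndicatrixCellCounting

/-!
# Route `UnthreadedDoor`, crux `PoloidalLiouville` (stmt-NavierStokesRegularity-1222), WALL W1 — crux idea «cell-flux», support toward
# Σ-0bR₂ `ClusterFluxNearCentreLipschitz`: CLASS OSCILLATIONS ARE DIFFERENCES OF SPHERE-CRITICAL VALUES (static half of the envelope principle)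

For `f` of class `C¹` off `x₀`, `r > 0`, and a class `K` of a cluster partition of `S_r(x₀)` for `f` (a nonempty union of cells of
`S_r(x₀) ∖ Γ`, `Γ = sheetTrace f x₀ r`): the supremum and the infimum of `f` over `K` are ATTAINED on `closure K` at SPHERE-CRITICAL points
(`∇f × (x − x₀) = 0`).  Reason: a maximiser over the compact `closure K ⊆ S_r(x₀)` either lies on a sheet trace (critical by definition) or
lies off `Γ`, and then — cells being relatively OPEN in the sphere (small preconnected caps, `Indicatrix.exists_isPreconnected_cap_subset`,
p728898) and classes being saturated unions of cells — a whole cap around it lies in `K`, so it is a local maximiser of `f` on the sphere and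
the Lagrange multiplier rule (`IsLocalExtrOn.exists_multipliers_of_hasStrictFDerivAt_1d`) makes it sphere-critical.  Consequently

  `clusterFlux f r 𝒦 = r · Σ_{K ∈ 𝒦} (f(x⁺_K) − f(x⁻_K))`,  `x^±_K ∈ closure K ∩ sphCrit f x₀ r`   (`clusterFlux_eq_finsum_criticalValues`).

This is the static half of the envelope principle behind Σ-0bR₂ (custodian ns-idea-14; `Theorems/UnthreadedDoorCellFluxWindowDecayDefs.lean`):
the flux of a rule is a signed sum of at most `2·(#classes)` sphere-critical values of the slice; the dynamic half (a persisting critical value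
moves at speed `∂_t T`, resp. `∂_r T`, at the point — no boundary-motion term, because class boundaries are critical curves) and the
finiteness of re-grouping events are what remains OPEN of Σ-0bR₂.

* `cross_gradient_eq_zero_of_isLocalExtrOn_sphere` — Lagrange on `S_r(x₀)`;
* `isClosed_sphCrit`, `exists_cap_subset_cellOf` (cells are relatively open), `cellOf_subset_of_mem_class` (classes are saturated),
  `exists_cap_subset_of_mem_closure_class`;
* `exists_sphCrit_isMaxOn_closure_class` / `…isMinOn…`, `exists_sphCrit_sSup_eq` / `exists_sphCrit_sInf_eq`, `exists_sphCrit_setOsc_eq`;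
* `clusterFlux_eq_finsum_criticalValues`.

HONEST LABEL: support lemmas strictly below W1; Σ-0bR₂, the cell-flux chain, `PoloidalLiouville` ⟨1222⟩, W1 and NS regularity are OPEN — NOT
proved.  `--supports stmt-NavierStokesRegularity-1222 --as helper`.  [folklore]
-/

noncomputable section

-- the summit and its single sub-problem share the name (CONVENTIONS §1)
set_option linter.dupNamespace false

open Set Function Filter Topology MeasureTheory Metric
open scoped RealInnerProductSpace

namespace Summit.NavierStokesRegularity.NavierStokesRegularity.Theorems.PoloidalLiouville.CellFlux

open Summit.NavierStokesRegularity.NavierStokesRegularity.Theorems.PoloidalLiouville.NetFlux (E3 ne_center_of_mem_sphere)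
open Summit.NavierStokesRegularity.NavierStokesRegularity.Theorems.PoloidalLiouville.Indicatrix (exists_isPreconnected_cap_subset)
open Literature.Analysis Literature.Analysis.FluidPDE

variable {f : E3 → ℝ} {x₀ : E3} {r : ℝ}

/-! ### Lagrange on the sphere -/

/-- A parallel gradient is sphere-critical: `(c • (x − x₀)) × (x − x₀) = 0`. [folklore] -/
theorem cross_smul_sub_self_eq_zero (c : ℝ) (x x₀ : E3) : cross (c • (x - x₀)) (x - x₀) = 0 := by
  simp [cross, map_smul, LinearMap.smul_apply]

/-- **Lagrange multiplier rule on the sphere.**  A local extremum of `f` on `S_r(x₀)` (`r > 0`) at which `f` is `C¹` is sphere-critical: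
`∇f(x) × (x − x₀) = 0`. [folklore] -/
theorem cross_gradient_eq_zero_of_isLocalExtrOn_sphere {x : E3} (hr : 0 < r) (hx : x ∈ sphere x₀ r)
    (hf : ContDiffAt ℝ 1 f x) (hextr : IsLocalExtrOn f (sphere x₀ r) x) :
    cross (gradient f x) (x - x₀) = 0 := by
  have hxn : ‖x - x₀‖ = r := mem_sphere_iff_norm.1 hx
  have hxne : x - x₀ ≠ 0 := by
    intro h
    rw [h, norm_zero] at hxn
    exact hr.ne' hxn.symm
  -- the constraint `g y = ‖y − x₀‖²` and its strict derivative
  have hg : HasStrictFDerivAt (fun y : E3 => ‖y - x₀‖ ^ 2) (2 • innerSL ℝ (x - x₀)) x := by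
    have h := (hasStrictFDerivAt_norm_sq (x - x₀)).comp x ((hasStrictFDerivAt_id x).sub_const x₀)
    simpa using h
  have hφ : HasStrictFDerivAt f (fderiv ℝ f x) x := hf.hasStrictFDerivAt one_ne_zero
  have hS : sphere x₀ r = {y : E3 | ‖y - x₀‖ ^ 2 = ‖x - x₀‖ ^ 2} := by
    ext y
    simp only [mem_sphere_iff_norm, mem_setOf_eq, hxn]
    constructor
    · intro h
      rw [h]
    · intro h
      exact (pow_left_inj₀ (norm_nonneg _) hr.le two_ne_zero).1 h
  rw [hS] at hextr
  obtain ⟨a, b, hab, hsum⟩ := hextr.exists_multipliers_of_hasStrictFDerivAt_1d hg hφ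
  have happ : ∀ w : E3, a * (2 * ⟪x - x₀, w⟫) + b * fderiv ℝ f x w = 0 := by
    intro w
    have h := congrArg (fun L : E3 →L[ℝ] ℝ => L w) hsum
    simpa [mul_assoc, inner_sub_left] using h
  have hb : b ≠ 0 := by
    intro hb0
    have ha : a ≠ 0 := by
      intro ha0
      exact hab (by rw [ha0, hb0]; rfl)
    have h := happ (x - x₀)
    rw [hb0, zero_mul, add_zero, real_inner_self_eq_norm_sq] at h
    have : ‖x - x₀‖ ^ 2 = 0 := by
      rcases mul_eq_zero.1 h with h1 | h2
      · exact absurd h1 ha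
      · linarith
    exact hxne (by simpa using this)
  -- the gradient is parallel to `x − x₀`
  have hgrad : gradient f x = (-(2 * a / b)) • (x - x₀) := by
    refine ext_inner_right ℝ fun w => ?_
    rw [gradient, InnerProductSpace.toDual_symm_apply, real_inner_smul_left]
    have h := happ w
    field_simp
    linarith
  rw [hgrad]
  exact cross_smul_sub_self_eq_zero _ _ _

/-! ### Cells are relatively open; classes are saturated -/

/-- The sphere-critical set of a `C¹` function is closed (`r > 0`). [folklore] -/
theorem isClosed_sphCrit (hr : 0 < r) (hf : ContDiffOn ℝ 1 f ({x₀}ᶜ : Set E3)) : IsClosed (sphCrit f x₀ r) := by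
  have hcont : ContinuousOn (fun x : E3 => cross (gradient f x) (x - x₀)) (sphere x₀ r) := by
    have hsub : sphere x₀ r ⊆ ({x₀}ᶜ : Set E3) := fun x hx => ne_center_of_mem_sphere hr hx
    have hfd : ContinuousOn (fderiv ℝ f) ({x₀}ᶜ : Set E3) := hf.continuousOn_fderiv_of_isOpen isOpen_compl_singleton le_rfl
    have hgr : ContinuousOn (gradient f) ({x₀}ᶜ : Set E3) :=
      (InnerProductSpace.toDual ℝ E3).symm.continuous.comp_continuousOn hfd
    have h2 : ContinuousOn (fun x : E3 => (gradient f x, x - x₀)) (sphere x₀ r) :=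
      (hgr.mono hsub).prodMk (by fun_prop)
    have h3 : Continuous (fun p : E3 × E3 => crossCLM p.1 p.2) := crossCLM.continuous₂
    have h4 := h3.comp_continuousOn h2
    simpa only [Function.comp_def, crossCLM_apply] using h4
  have h := hcont.preimage_isClosed_of_isClosed isClosed_sphere (isClosed_singleton (x := (0 : E3)))
  convert h using 1
  ext x
  simp [sphCrit, mem_preimage]

/-- **Cells are relatively open in the sphere**: a point of `S_r(x₀) ∖ Γ` has a cap `S_r(x₀) ∩ B(x, ε)` inside its cell. [folklore] -/
theorem exists_cap_subset_cellOf {x : E3} (hr : 0 < r) (hf : ContDiffOn ℝ 1 f ({x₀}ᶜ : Set E3))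
    (hx : x ∈ sphere x₀ r \ sheetTrace f x₀ r) :
    ∃ ε > (0 : ℝ), sphere x₀ r ∩ ball x ε ⊆ cellOf f x₀ r x := by
  -- a neighbourhood of `x` missing the sheet traces
  obtain ⟨U, hU, hUΓ⟩ : ∃ U ∈ 𝓝 x, ∀ y ∈ U, y ∉ sheetTrace f x₀ r := by
    by_cases hxZ : x ∈ sphCrit f x₀ r
    · -- `x` is an isolated sphere-critical point
      have hnacc : ¬ AccPt x (𝓟 (sphCrit f x₀ r)) := fun h => hx.2 ⟨hxZ, h⟩
      rw [accPt_iff_nhds] at hnacc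
      push Not at hnacc
      obtain ⟨U, hU, hUZ⟩ := hnacc
      refine ⟨U, hU, fun y hyU hyΓ => ?_⟩
      have hyx : y = x := hUZ y ⟨hyU, hyΓ.1⟩
      rw [hyx] at hyΓ
      exact hx.2 hyΓ
    · exact ⟨(sphCrit f x₀ r)ᶜ, (isClosed_sphCrit hr hf).isOpen_compl.mem_nhds hxZ, fun y hy hyΓ => hy hyΓ.1⟩
  obtain ⟨ε, hε, K, hKSU, hKconn, hKball⟩ := exists_isPreconnected_cap_subset hr hx.1 hU
  have hKY : K ⊆ sphere x₀ r \ sheetTrace f x₀ r := fun z hz => ⟨(hKSU hz).1, hUΓ z (hKSU hz).2⟩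
  have hxK : x ∈ K := hKball ⟨hx.1, mem_ball_self hε⟩
  exact ⟨ε, hε, hKball.trans (hKconn.subset_connectedComponentIn hxK hKY)⟩

/-- **Classes are saturated**: a class of a cluster partition contains the cell of each of its points, and lies in `S_r(x₀) ∖ Γ`. [folklore] -/
theorem cellOf_subset_of_mem_class {𝒦 : Set (Set E3)} {K : Set E3} (h𝒦 : IsClusterPartition f x₀ r 𝒦) (hK : K ∈ 𝒦) :
    K ⊆ sphere x₀ r \ sheetTrace f x₀ r ∧ ∀ z ∈ K, cellOf f x₀ r z ⊆ K := by
  obtain ⟨_, 𝒪, h𝒪, rfl⟩ := h𝒦.2.1 K hK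
  constructor
  · intro z hz
    obtain ⟨C, hC, hzC⟩ := mem_sUnion.1 hz
    obtain ⟨w, _, rfl⟩ := h𝒪 hC
    exact connectedComponentIn_subset _ _ hzC
  · intro z hz
    obtain ⟨C, hC, hzC⟩ := mem_sUnion.1 hz
    obtain ⟨w, _, rfl⟩ := h𝒪 hC
    have hEq : cellOf f x₀ r w = cellOf f x₀ r z := connectedComponentIn_eq hzC
    rw [← hEq]
    exact subset_sUnion_of_mem hC

/-- A point of `closure K` off the sheet traces, for a saturated `K ⊆ S_r(x₀) ∖ Γ`, carries a whole cap inside `K` (in particular it lies in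
`K`). [folklore] -/
theorem exists_cap_subset_of_mem_closure_class {K : Set E3} {x : E3} (hr : 0 < r) (hf : ContDiffOn ℝ 1 f ({x₀}ᶜ : Set E3))
    (hKS : K ⊆ sphere x₀ r \ sheetTrace f x₀ r) (hsat : ∀ z ∈ K, cellOf f x₀ r z ⊆ K)
    (hxK : x ∈ closure K) (hxS : x ∈ sphere x₀ r) (hxΓ : x ∉ sheetTrace f x₀ r) :
    ∃ ε > (0 : ℝ), sphere x₀ r ∩ ball x ε ⊆ K := by
  obtain ⟨ε, hε, hcap⟩ := exists_cap_subset_cellOf hr hf ⟨hxS, hxΓ⟩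
  obtain ⟨z, hzK, hzx⟩ : ∃ z ∈ K, dist x z < ε := Metric.mem_closure_iff.1 hxK ε hε
  have hz : z ∈ cellOf f x₀ r x := hcap ⟨(hKS hzK).1, mem_ball'.2 hzx⟩
  have hEq : cellOf f x₀ r x = cellOf f x₀ r z := connectedComponentIn_eq hz
  exact ⟨ε, hε, hcap.trans (hEq ▸ hsat z hzK)⟩

/-! ### Extrema over a class are attained at sphere-critical points -/

/-- **A maximiser of `f` over the closure of a class is sphere-critical.**  For `f ∈ C¹` off `x₀`, `r > 0`, and a nonempty saturated
`K ⊆ S_r(x₀) ∖ Γ` (e.g. a class of a cluster partition): some `x ∈ closure K ∩ sphCrit f x₀ r` maximises `f` on `closure K`. [folklore] -/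
theorem exists_sphCrit_isMaxOn_closure_class {K : Set E3} (hr : 0 < r) (hf : ContDiffOn ℝ 1 f ({x₀}ᶜ : Set E3))
    (hKS : K ⊆ sphere x₀ r \ sheetTrace f x₀ r) (hsat : ∀ z ∈ K, cellOf f x₀ r z ⊆ K) (hne : K.Nonempty) :
    ∃ x ∈ closure K, x ∈ sphCrit f x₀ r ∧ IsMaxOn f (closure K) x := by
  have hclS : closure K ⊆ sphere x₀ r := closure_minimal (fun z hz => (hKS hz).1) isClosed_sphere
  have hcpt : IsCompact (closure K) := (isCompact_sphere x₀ r).of_isClosed_subset isClosed_closure hclS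
  have hsub : sphere x₀ r ⊆ ({x₀}ᶜ : Set E3) := fun x hx => ne_center_of_mem_sphere hr hx
  have hfc : ContinuousOn f (closure K) := hf.continuousOn.mono (hclS.trans hsub)
  obtain ⟨x, hx, hmax⟩ := hcpt.exists_isMaxOn (hne.mono subset_closure) hfc
  refine ⟨x, hx, ?_, hmax⟩
  by_cases hxΓ : x ∈ sheetTrace f x₀ r
  · exact hxΓ.1
  · -- off the traces: a cap around `x` lies in `K`, so `x` is a local maximiser on the sphere
    have hxS : x ∈ sphere x₀ r := hclS hx
    obtain ⟨ε, hε, hcap⟩ := exists_cap_subset_of_mem_closure_class hr hf hKS hsat hx hxS hxΓ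
    have hloc : IsLocalMaxOn f (sphere x₀ r) x := by
      have hmem : sphere x₀ r ∩ ball x ε ∈ 𝓝[sphere x₀ r] x := inter_mem_nhdsWithin _ (ball_mem_nhds x hε)
      exact Filter.mem_of_superset hmem fun y hy => hmax (subset_closure (hcap hy))
    have hfx : ContDiffAt ℝ 1 f x := hf.contDiffAt (isOpen_compl_singleton.mem_nhds (hsub hxS))
    exact ⟨hxS, cross_gradient_eq_zero_of_isLocalExtrOn_sphere hr hxS hfx hloc.isExtr⟩

/-- **A minimiser of `f` over the closure of a class is sphere-critical** (`exists_sphCrit_isMaxOn_closure_class` for `−f`). [folklore] -/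
theorem exists_sphCrit_isMinOn_closure_class {K : Set E3} (hr : 0 < r) (hf : ContDiffOn ℝ 1 f ({x₀}ᶜ : Set E3))
    (hKS : K ⊆ sphere x₀ r \ sheetTrace f x₀ r) (hsat : ∀ z ∈ K, cellOf f x₀ r z ⊆ K) (hne : K.Nonempty) :
    ∃ x ∈ closure K, x ∈ sphCrit f x₀ r ∧ IsMinOn f (closure K) x := by
  have hclS : closure K ⊆ sphere x₀ r := closure_minimal (fun z hz => (hKS hz).1) isClosed_sphere
  have hcpt : IsCompact (closure K) := (isCompact_sphere x₀ r).of_isClosed_subset isClosed_closure hclS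
  have hsub : sphere x₀ r ⊆ ({x₀}ᶜ : Set E3) := fun x hx => ne_center_of_mem_sphere hr hx
  have hfc : ContinuousOn f (closure K) := hf.continuousOn.mono (hclS.trans hsub)
  obtain ⟨x, hx, hmin⟩ := hcpt.exists_isMinOn (hne.mono subset_closure) hfc
  refine ⟨x, hx, ?_, hmin⟩
  by_cases hxΓ : x ∈ sheetTrace f x₀ r
  · exact hxΓ.1
  · have hxS : x ∈ sphere x₀ r := hclS hx
    obtain ⟨ε, hε, hcap⟩ := exists_cap_subset_of_mem_closure_class hr hf hKS hsat hx hxS hxΓ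
    have hloc : IsLocalMinOn f (sphere x₀ r) x := by
      have hmem : sphere x₀ r ∩ ball x ε ∈ 𝓝[sphere x₀ r] x := inter_mem_nhdsWithin _ (ball_mem_nhds x hε)
      exact Filter.mem_of_superset hmem fun y hy => hmin (subset_closure (hcap hy))
    have hfx : ContDiffAt ℝ 1 f x := hf.contDiffAt (isOpen_compl_singleton.mem_nhds (hsub hxS))
    exact ⟨hxS, cross_gradient_eq_zero_of_isLocalExtrOn_sphere hr hxS hfx hloc.isExtr⟩

/-- **The supremum of `f` over a class is a sphere-critical value** attained on `closure K`. [folklore] -/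
theorem exists_sphCrit_sSup_eq {K : Set E3} (hr : 0 < r) (hf : ContDiffOn ℝ 1 f ({x₀}ᶜ : Set E3))
    (hKS : K ⊆ sphere x₀ r \ sheetTrace f x₀ r) (hsat : ∀ z ∈ K, cellOf f x₀ r z ⊆ K) (hne : K.Nonempty) :
    ∃ x ∈ closure K, x ∈ sphCrit f x₀ r ∧ sSup (f '' K) = f x := by
  obtain ⟨x, hx, hcrit, hmax⟩ := exists_sphCrit_isMaxOn_closure_class hr hf hKS hsat hne
  have hclS : closure K ⊆ sphere x₀ r := closure_minimal (fun z hz => (hKS hz).1) isClosed_sphere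
  have hsub : sphere x₀ r ⊆ ({x₀}ᶜ : Set E3) := fun x hx => ne_center_of_mem_sphere hr hx
  have hfc : ContinuousOn f (closure K) := hf.continuousOn.mono (hclS.trans hsub)
  have hbdd : BddAbove (f '' K) := ⟨f x, by rintro _ ⟨z, hz, rfl⟩; exact hmax (subset_closure hz)⟩
  refine ⟨x, hx, hcrit, le_antisymm (csSup_le (hne.image f) ?_) ?_⟩
  · rintro _ ⟨z, hz, rfl⟩
    exact hmax (subset_closure hz)
  · -- `f x ∈ closure (f '' K) ⊆ Iic (sSup (f '' K))`
    have hfx : f x ∈ closure (f '' K) := hfc.image_closure ⟨x, hx, rfl⟩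
    exact (closure_minimal (fun y hy => le_csSup hbdd hy) isClosed_Iic : closure (f '' K) ⊆ Iic (sSup (f '' K))) hfx

/-- **The infimum of `f` over a class is a sphere-critical value** attained on `closure K`. [folklore] -/
theorem exists_sphCrit_sInf_eq {K : Set E3} (hr : 0 < r) (hf : ContDiffOn ℝ 1 f ({x₀}ᶜ : Set E3))
    (hKS : K ⊆ sphere x₀ r \ sheetTrace f x₀ r) (hsat : ∀ z ∈ K, cellOf f x₀ r z ⊆ K) (hne : K.Nonempty) :
    ∃ x ∈ closure K, x ∈ sphCrit f x₀ r ∧ sInf (f '' K) = f x := by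
  obtain ⟨x, hx, hcrit, hmin⟩ := exists_sphCrit_isMinOn_closure_class hr hf hKS hsat hne
  have hclS : closure K ⊆ sphere x₀ r := closure_minimal (fun z hz => (hKS hz).1) isClosed_sphere
  have hsub : sphere x₀ r ⊆ ({x₀}ᶜ : Set E3) := fun x hx => ne_center_of_mem_sphere hr hx
  have hfc : ContinuousOn f (closure K) := hf.continuousOn.mono (hclS.trans hsub)
  have hbdd : BddBelow (f '' K) := ⟨f x, by rintro _ ⟨z, hz, rfl⟩; exact hmin (subset_closure hz)⟩
  refine ⟨x, hx, hcrit, le_antisymm ?_ (le_csInf (hne.image f) ?_)⟩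
  · have hfx : f x ∈ closure (f '' K) := hfc.image_closure ⟨x, hx, rfl⟩
    exact (closure_minimal (fun y hy => csInf_le hbdd hy) isClosed_Ici : closure (f '' K) ⊆ Ici (sInf (f '' K))) hfx
  · rintro _ ⟨z, hz, rfl⟩
    exact hmin (subset_closure hz)

/-- **The oscillation of `f` over a class is a difference of two sphere-critical values** attained on `closure K`. [folklore] -/
theorem exists_sphCrit_setOsc_eq {K : Set E3} (hr : 0 < r) (hf : ContDiffOn ℝ 1 f ({x₀}ᶜ : Set E3))
    (hKS : K ⊆ sphere x₀ r \ sheetTrace f x₀ r) (hsat : ∀ z ∈ K, cellOf f x₀ r z ⊆ K) (hne : K.Nonempty) :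
    ∃ p ∈ closure K ∩ sphCrit f x₀ r, ∃ q ∈ closure K ∩ sphCrit f x₀ r, setOsc f K = f p - f q := by
  obtain ⟨p, hp, hpc, hps⟩ := exists_sphCrit_sSup_eq hr hf hKS hsat hne
  obtain ⟨q, hq, hqc, hqs⟩ := exists_sphCrit_sInf_eq hr hf hKS hsat hne
  exact ⟨p, ⟨hp, hpc⟩, q, ⟨hq, hqc⟩, by rw [setOsc, hps, hqs]⟩

/-! ### The cluster flux as a signed sum of critical values -/

/-- **The cluster flux of a cluster partition is a signed sum of sphere-critical values**: there are selections `p K, q K ∈ closure K ∩ sphCrit`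
(`K ∈ 𝒦`) with `setOsc f K = f (p K) − f (q K)`, hence `clusterFlux f r 𝒦 = r · Σ_{K ∈ 𝒦} (f (p K) − f (q K))` — at most `2 · #𝒦` critical
values of the slice enter.  (Static half of the envelope principle behind Σ-0bR₂.) [folklore] -/
theorem clusterFlux_eq_finsum_criticalValues {𝒦 : Set (Set E3)} (hr : 0 < r) (hf : ContDiffOn ℝ 1 f ({x₀}ᶜ : Set E3))
    (h𝒦 : IsClusterPartition f x₀ r 𝒦) :
    ∃ p q : Set E3 → E3,
      (∀ K ∈ 𝒦, p K ∈ closure K ∩ sphCrit f x₀ r ∧ q K ∈ closure K ∩ sphCrit f x₀ r ∧ setOsc f K = f (p K) - f (q K)) ∧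
      clusterFlux f r 𝒦 = r * ∑ᶠ K ∈ 𝒦, (f (p K) - f (q K)) := by
  classical
  have hex : ∀ K ∈ 𝒦, ∃ p ∈ closure K ∩ sphCrit f x₀ r, ∃ q ∈ closure K ∩ sphCrit f x₀ r, setOsc f K = f p - f q := by
    intro K hK
    obtain ⟨hKS, hsat⟩ := cellOf_subset_of_mem_class h𝒦 hK
    exact exists_sphCrit_setOsc_eq hr hf hKS hsat (h𝒦.2.1 K hK).1
  choose! p hp q hq hosc using hex
  refine ⟨p, q, fun K hK => ⟨hp K hK, hq K hK, hosc K hK⟩, ?_⟩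
  rw [clusterFlux]
  congr 1
  exact finsum_mem_congr rfl fun K hK => hosc K hK

end Summit.NavierStokesRegularity.NavierStokesRegularity.Theorems.PoloidalLiouville.CellFlux

end
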